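import Literature.Analysis.ODE.RecursiveSeries
import HarnessLib

/-!
# The Frobenius series at a pole of the spheroidal equation with azimuthal index `m` and complex
# parameters, jointly smooth in the variable and the parameters

Topic `Literature/Analysis/SpecialFunctions` (namespace `Literature.Analysis.SpecialFunctions`).
The angular equation of a separated solution `e^{-iωt} e^{imφ} S(θ) R(r)` of the Klein–Gordon
equation on Kerr is the spheroidal equation (Shlapentokh-Rothman, CMP 329 (2014), §2, (2.1);
NIST DLMF §30.2)
  `(1/sin θ)(sin θ S')' − (m²/sin²θ) S + κ cos²θ S + λ S = 0`,  `κ = a²(ω² − μ²) ∈ ℂ`.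
With `x = cos θ` and `S = (1 − x²)^{m/2} q` (`m ≥ 0`; the sign of the azimuthal number is
immaterial) it becomes
  `(1 − x²) q'' − 2(m+1) x q' + (ν + κ x²) q = 0`,  `ν = λ − m(m+1)`,
whose pole `x = 1` is a regular singular point with indicial exponents `0` and `−m`; smoothness of
`e^{imφ} S(θ)` on the sphere near the pole is exactly regularity of `q` at `x = 1`. In the variable
`t = 1 − x` the equation reads `t(2 − t) q'' + 2(m+1)(1 − t) q' + (ν + κ(1 − t)²) q = 0` and its
solution analytic at `t = 0` with `q(0) = 1` is `Σ cₖ tᵏ` with (undetermined coefficients)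
  `c₀ = 1`,  `2(k+1)(k+m+1) c_{k+1} = (k(k+2m+1) − ν − κ) cₖ + 2κ c_{k−1} − κ c_{k−2}`.
This file constructs that solution for all `m : ℕ` and all COMPLEX `(ν, κ)` and proves, on every
parameter disc `‖ν‖ + ‖κ‖ < R`:

* `sphmCoeff m ν κ k` — the coefficients, the recursion, polynomial (hence smooth) dependence on
  `(ν, κ)`, reality for real parameters;
* **the geometric bound** `‖cₖ‖ ≤ 16 (k+1)^N (2/3)ᵏ` with an explicit `N = N(m, R)`
  (`norm_sphmCoeff_le`): the coefficient sequence, rescaled by `(3/2)ᵏ/(k+1)^N`, is the fixed point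
  of a recursion operator of norm `≤ 15/16` on `ℕ →ᵇ ℂ` (`Literature.Analysis.ODE.affineFix`,
  `RecursiveSeries.lean`) — in particular the radius of convergence is `≥ 3/2 > 1`, so the series
  reaches past the equator `x = 0` (`t = 1`);
* `sphmFun m ν κ t = Σ cₖ tᵏ` — the solution on `|t| < 5/4`: the ODE (`sphmFun_ode`), its
  `t`-derivatives as series, and **joint smoothness of `(t, ν, κ) ↦ sphmFun m ν κ t`** and of the
  `t`-derivative on `{|t| < 5/4} × {‖ν‖ + ‖κ‖ < R}` (`contDiffOn_sphmFun`,
  `contDiffOn_sphmDer`), from the smooth dependence of contraction fixed points on parameters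
  (`Literature.Analysis.ODE.contDiffAt_affineFix`) and of `Σ bₖ xᵏ` on `(x, b)`
  (`Literature.Analysis.ODE.contDiffAt_cseries_param`).

This is the input of the shooting construction of the angular eigenvalue curves `λ_{ml}(κ)`
(SR, CMP 329 (2014), App. B, "we embed the eigenvalues into holomorphic curves") for `m ≠ 0`;
the case `m = 0` with real parameters in a small box is `SpheroidalSeries.lean`.

## References

* Y. Shlapentokh-Rothman, *Exponentially growing finite energy solutions for the Klein–Gordon
  equation on sub-extremal Kerr spacetimes*, Comm. Math. Phys. 329 (2014) 859–891, §2 (2.1) and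
  App. B. Key `ShlapentokhRothman2014KleinGordon`.
* P. Hartman, *Ordinary Differential Equations*, SIAM Classics 38 (2002), Ch. IV §12 ((12.12):
  undetermined coefficients at a regular singular point; Exercise 12.3 (c): the associated Legendre
  equation). Key `Hartman2002`.
-/

noncomputable section

open Set Filter Metric Topology
open scoped ContDiff ComplexConjugate

namespace Literature.Analysis.SpecialFunctions

open Literature.Analysis.ODE

/-! ### The Frobenius coefficients -/

/-- Three consecutive Frobenius coefficients `(cₖ, cₖ₊₁, cₖ₊₂)` of the regular solution at the pole
of the `m`-spheroidal equation (`c₀ = 1`, `c₁ = −(ν + κ)/(2(m+1))`,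
`4(m+2) c₂ = ((2m+2) − ν − κ) c₁ + 2κ`, and
`2(k+3)(k+m+3) c_{k+3} = ((k+2)(k+2m+3) − ν − κ) c_{k+2} + 2κ c_{k+1} − κ cₖ`).
SR, CMP 329 (2014), §2 (2.1) with App. B; Hartman Ch. IV §12 (12.12).
[cite: ShlapentokhRothman2014KleinGordon, §2 (2.1)] -/
def sphmTriple (m : ℕ) (ν κ : ℂ) : ℕ → ℂ × ℂ × ℂ
  | 0 =>
    (1, -(ν + κ) / (2 * ((m : ℂ) + 1)),
      (((2 * (m : ℂ) + 2) - ν - κ) * (-(ν + κ) / (2 * ((m : ℂ) + 1))) + 2 * κ) / (4 * ((m : ℂ) + 2)))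
  | k + 1 =>
    ((sphmTriple m ν κ k).2.1, (sphmTriple m ν κ k).2.2,
      ((((k : ℂ) + 2) * ((k : ℂ) + 2 * m + 3) - ν - κ) * (sphmTriple m ν κ k).2.2 +
          2 * κ * (sphmTriple m ν κ k).2.1 - κ * (sphmTriple m ν κ k).1) /
        (2 * ((k : ℂ) + 3) * ((k : ℂ) + m + 3)))

/-- **The Frobenius coefficients `cₖ(m; ν, κ)`** of the solution `Σ cₖ (1 − x)ᵏ`, regular at the
pole `x = 1` and equal to `1` there, of `(1 − x²) q'' − 2(m+1) x q' + (ν + κx²) q = 0`.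
[cite: ShlapentokhRothman2014KleinGordon, §2 (2.1)] -/
def sphmCoeff (m : ℕ) (ν κ : ℂ) (k : ℕ) : ℂ := (sphmTriple m ν κ k).1

/-- `c₀ = 1`. [folklore] -/
@[simp] theorem sphmCoeff_zero (m : ℕ) (ν κ : ℂ) : sphmCoeff m ν κ 0 = 1 := rfl

/-- `c₁ = −(ν + κ)/(2(m+1))` (the recursion at `k = 0`). [folklore] -/
theorem sphmCoeff_one (m : ℕ) (ν κ : ℂ) : sphmCoeff m ν κ 1 = -(ν + κ) / (2 * ((m : ℂ) + 1)) := rfl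

/-- `c₂ = (((2m+2) − ν − κ) c₁ + 2κ)/(4(m+2))` (the recursion at `k = 1`). [folklore] -/
theorem sphmCoeff_two (m : ℕ) (ν κ : ℂ) :
    sphmCoeff m ν κ 2 =
      (((2 * (m : ℂ) + 2) - ν - κ) * (-(ν + κ) / (2 * ((m : ℂ) + 1))) + 2 * κ) / (4 * ((m : ℂ) + 2)) := rfl

/-- **The recursion** `2(k+3)(k+m+3) c_{k+3} = ((k+2)(k+2m+3) − ν − κ) c_{k+2} + 2κ c_{k+1} − κ cₖ`.
[cite: ShlapentokhRothman2014KleinGordon, §2 (2.1)] -/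
theorem sphmCoeff_add_three (m : ℕ) (ν κ : ℂ) (k : ℕ) :
    sphmCoeff m ν κ (k + 3) =
      ((((k : ℂ) + 2) * ((k : ℂ) + 2 * m + 3) - ν - κ) * sphmCoeff m ν κ (k + 2) +
          2 * κ * sphmCoeff m ν κ (k + 1) - κ * sphmCoeff m ν κ k) /
        (2 * ((k : ℂ) + 3) * ((k : ℂ) + m + 3)) := rfl

/-- The recursion in multiplied-out form, valid for all `k ≥ 0` with the convention
`c₋₁ = c₋₂ = 0`: `2(k+1)(k+m+1) c_{k+1} = (k(k+2m+1) − ν − κ) cₖ + 2κ c_{k−1} − κ c_{k−2}`, stated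
for `k`, `k+1`, `k+2` separately below. [folklore] -/
theorem sphmCoeff_rec_zero (m : ℕ) (ν κ : ℂ) :
    2 * (1 : ℂ) * ((0 : ℂ) + m + 1) * sphmCoeff m ν κ 1 = ((0 : ℂ) * (0 + 2 * m + 1) - ν - κ) * sphmCoeff m ν κ 0 := by
  rw [sphmCoeff_one, sphmCoeff_zero]
  have h : (m : ℂ) + 1 ≠ 0 := by
    have : (0 : ℝ) < (m : ℝ) + 1 := by positivity
    exact_mod_cast this.ne'
  field_simp
  ring

/-- The recursion at `k = 1`. [folklore] -/
theorem sphmCoeff_rec_one (m : ℕ) (ν κ : ℂ) :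
    2 * (2 : ℂ) * ((1 : ℂ) + m + 1) * sphmCoeff m ν κ 2 =
      ((1 : ℂ) * (1 + 2 * m + 1) - ν - κ) * sphmCoeff m ν κ 1 + 2 * κ * sphmCoeff m ν κ 0 := by
  rw [sphmCoeff_two, sphmCoeff_one, sphmCoeff_zero]
  have h1 : (m : ℂ) + 1 ≠ 0 := by
    have : (0 : ℝ) < (m : ℝ) + 1 := by positivity
    exact_mod_cast this.ne'
  have h2 : (m : ℂ) + 2 ≠ 0 := by
    have : (0 : ℝ) < (m : ℝ) + 2 := by positivity
    exact_mod_cast this.ne'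
  field_simp
  ring

/-- The recursion at `k + 2`. [folklore] -/
theorem sphmCoeff_rec_add_two (m : ℕ) (ν κ : ℂ) (k : ℕ) :
    2 * ((k : ℂ) + 3) * (((k : ℂ) + 2) + m + 1) * sphmCoeff m ν κ (k + 3) =
      (((k : ℂ) + 2) * ((k : ℂ) + 2 + 2 * m + 1) - ν - κ) * sphmCoeff m ν κ (k + 2) +
        2 * κ * sphmCoeff m ν κ (k + 1) - κ * sphmCoeff m ν κ k := by
  rw [sphmCoeff_add_three]
  have h1 : (k : ℂ) + 3 ≠ 0 := by
    have : (0 : ℝ) < (k : ℝ) + 3 := by positivity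
    exact_mod_cast this.ne'
  have h2 : (k : ℂ) + m + 3 ≠ 0 := by
    have : (0 : ℝ) < (k : ℝ) + m + 3 := by positivity
    exact_mod_cast this.ne'
  rw [show ((k : ℂ) + 2) + m + 1 = (k : ℂ) + m + 3 by ring]
  field_simp
  ring

/-! ### Polynomial dependence on the parameters and reality -/

/-- The coefficients depend smoothly (indeed polynomially) on `(ν, κ)`. [folklore] -/
theorem contDiff_sphmTriple (m : ℕ) (k : ℕ) {n : WithTop ℕ∞} :
    ContDiff ℂ n fun p : ℂ × ℂ ↦ sphmTriple m p.1 p.2 k := by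
  induction k with
  | zero =>
    simp only [sphmTriple]
    have h1 : (2 : ℂ) * ((m : ℂ) + 1) ≠ 0 := by
      have : (0 : ℝ) < 2 * ((m : ℝ) + 1) := by positivity
      exact_mod_cast this.ne'
    have h2 : (4 : ℂ) * ((m : ℂ) + 2) ≠ 0 := by
      have : (0 : ℝ) < 4 * ((m : ℝ) + 2) := by positivity
      exact_mod_cast this.ne'
    fun_prop (disch := assumption)
  | succ k ih =>
    simp only [sphmTriple]
    have h : (2 : ℂ) * ((k : ℂ) + 3) * ((k : ℂ) + m + 3) ≠ 0 := by
      have : (0 : ℝ) < 2 * ((k : ℝ) + 3) * ((k : ℝ) + m + 3) := by positivity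
      exact_mod_cast this.ne'
    have h1 : ContDiff ℂ n fun p : ℂ × ℂ ↦ (sphmTriple m p.1 p.2 k).1 := contDiff_fst.comp ih
    have h2 : ContDiff ℂ n fun p : ℂ × ℂ ↦ (sphmTriple m p.1 p.2 k).2.1 :=
      contDiff_fst.comp (contDiff_snd.comp ih)
    have h3 : ContDiff ℂ n fun p : ℂ × ℂ ↦ (sphmTriple m p.1 p.2 k).2.2 :=
      contDiff_snd.comp (contDiff_snd.comp ih)
    fun_prop (disch := assumption)

/-- `(ν, κ) ↦ cₖ(m; ν, κ)` is smooth. [folklore] -/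
theorem contDiff_sphmCoeff (m : ℕ) (k : ℕ) {n : WithTop ℕ∞} :
    ContDiff ℂ n fun p : ℂ × ℂ ↦ sphmCoeff m p.1 p.2 k :=
  contDiff_fst.comp (contDiff_sphmTriple m k)

/-- **Reality**: for real `ν`, `κ` all coefficients are real. [folklore] -/
theorem im_sphmTriple (m : ℕ) {ν κ : ℂ} (hν : ν.im = 0) (hκ : κ.im = 0) (k : ℕ) :
    (sphmTriple m ν κ k).1.im = 0 ∧ (sphmTriple m ν κ k).2.1.im = 0 ∧ (sphmTriple m ν κ k).2.2.im = 0 := by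
  -- work with `conj z = z`
  have hνc : conj ν = ν := Complex.conj_eq_iff_im.2 hν
  have hκc : conj κ = κ := Complex.conj_eq_iff_im.2 hκ
  suffices h : conj (sphmTriple m ν κ k).1 = (sphmTriple m ν κ k).1 ∧
      conj (sphmTriple m ν κ k).2.1 = (sphmTriple m ν κ k).2.1 ∧
      conj (sphmTriple m ν κ k).2.2 = (sphmTriple m ν κ k).2.2 from
    ⟨Complex.conj_eq_iff_im.1 h.1, Complex.conj_eq_iff_im.1 h.2.1, Complex.conj_eq_iff_im.1 h.2.2⟩
  induction k with
  | zero =>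
    simp only [sphmTriple]
    refine ⟨map_one _, ?_, ?_⟩ <;> simp [map_div₀, map_neg, map_add, map_mul, map_sub, hνc, hκc, map_ofNat]
  | succ k ih =>
    obtain ⟨h1, h2, h3⟩ := ih
    simp only [sphmTriple]
    refine ⟨h2, h3, ?_⟩
    simp [map_div₀, map_add, map_mul, map_sub, hνc, hκc, h1, h2, h3, map_ofNat]

/-- For real `ν`, `κ` the coefficient `cₖ` is real. [folklore] -/
theorem im_sphmCoeff (m : ℕ) {ν κ : ℂ} (hν : ν.im = 0) (hκ : κ.im = 0) (k : ℕ) :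
    (sphmCoeff m ν κ k).im = 0 :=
  (im_sphmTriple m hν hκ k).1

/-! ### The rescaled coefficient sequence as a contraction fixed point -/

section Engine

/-- The polynomial weights `Wₖ = (k+1)^N`. [folklore] -/
def sphW (N k : ℕ) : ℝ := ((k : ℝ) + 1) ^ N

/-- `Wₖ > 0`. [folklore] -/
theorem sphW_pos (N k : ℕ) : 0 < sphW N k := by unfold sphW; positivity

/-- `Wₖ / Wⱼ ≤ 1` for `k ≤ j`. [folklore] -/
theorem sphW_div_le_one {N k j : ℕ} (h : k ≤ j) : sphW N k / sphW N j ≤ 1 := by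
  rw [div_le_one (sphW_pos N j)]
  unfold sphW
  have hk : (0 : ℝ) ≤ (k : ℝ) + 1 := by positivity
  have hkj : (k : ℝ) + 1 ≤ (j : ℝ) + 1 := by exact_mod_cast Nat.succ_le_succ h
  exact pow_le_pow_left₀ hk hkj N

/-- Bernoulli: `(x/(x+1))^N ≤ x/(x+N)` for `x > 0`. [folklore] -/
theorem div_add_one_pow_le (N : ℕ) {x : ℝ} (hx : 0 < x) : (x / (x + 1)) ^ N ≤ x / (x + N) := by
  have h0 : (0 : ℝ) ≤ 1 / x := by positivity
  have hB : 1 + (N : ℝ) * (1 / x) ≤ (1 + 1 / x) ^ N := one_add_mul_le_pow (by linarith) N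
  have hpos : 0 < 1 + (N : ℝ) * (1 / x) := by positivity
  have h1 : x / (x + 1) = (1 + 1 / x)⁻¹ := by field_simp
  rw [h1, inv_pow]
  calc ((1 + 1 / x) ^ N)⁻¹ ≤ (1 + (N : ℝ) * (1 / x))⁻¹ := inv_anti₀ hpos hB
    _ = x / (x + N) := by field_simp

/-- The decay of the weight ratios: `Wₖ / Wⱼ ≤ (k+1)/(k+1+N)` for `k < j`. [folklore] -/
theorem sphW_div_le {N k j : ℕ} (h : k < j) : sphW N k / sphW N j ≤ ((k : ℝ) + 1) / ((k : ℝ) + 1 + N) := by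
  have h1 : sphW N k / sphW N j ≤ sphW N k / sphW N (k + 1) := by
    refine div_le_div_of_nonneg_left (sphW_pos N k).le (sphW_pos N (k + 1)) ?_
    unfold sphW
    have hk : (0 : ℝ) ≤ ((k + 1 : ℕ) : ℝ) + 1 := by positivity
    have hkj : ((k + 1 : ℕ) : ℝ) + 1 ≤ (j : ℝ) + 1 := by exact_mod_cast Nat.succ_le_succ h
    exact pow_le_pow_left₀ hk hkj N
  refine h1.trans ?_
  unfold sphW
  push_cast
  rw [← div_pow, show (k : ℝ) + 1 + 1 = ((k : ℝ) + 1) + 1 by ring]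
  exact div_add_one_pow_le N (by linarith [k.cast_nonneg (α := ℝ)])

/-- The symbol of the one-step multiplier (its `(ν + κ)`-independent part), at output index `k+1`:
`(3/2) (Wₖ/Wₖ₊₁) · k(k+2m+1)/(2(k+1)(k+m+1))`. [folklore] -/
def symA (m N : ℕ) : ℕ → ℝ
  | 0 => 0
  | k + 1 => 3 / 2 * (sphW N k / sphW N (k + 1)) * ((k : ℝ) * ((k : ℝ) + 2 * m + 1) / (2 * ((k : ℝ) + 1) * ((k : ℝ) + m + 1)))

/-- The symbol multiplying `−(ν + κ)` in the one-step multiplier, at output index `k+1`: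
`(3/2) (Wₖ/Wₖ₊₁) / (2(k+1)(k+m+1))`. [folklore] -/
def symB (m N : ℕ) : ℕ → ℝ
  | 0 => 0
  | k + 1 => 3 / 2 * (sphW N k / sphW N (k + 1)) * (1 / (2 * ((k : ℝ) + 1) * ((k : ℝ) + m + 1)))

/-- The symbol multiplying `κ` in the two-step multiplier, at output index `k+2`:
`(3/2)² (Wₖ/Wₖ₊₂) / ((k+2)(k+m+2))`. [folklore] -/
def symB1 (m N : ℕ) : ℕ → ℝ
  | 0 => 0
  | 1 => 0
  | k + 2 => (3 / 2) ^ 2 * (sphW N k / sphW N (k + 2)) * (1 / (((k : ℝ) + 2) * ((k : ℝ) + m + 2)))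

/-- The symbol multiplying `κ` in the three-step multiplier, at output index `k+3`:
`−(3/2)³ (Wₖ/Wₖ₊₃) / (2(k+3)(k+m+3))`. [folklore] -/
def symB2 (m N : ℕ) : ℕ → ℝ
  | 0 => 0
  | 1 => 0
  | 2 => 0
  | k + 3 => -(3 / 2) ^ 3 * (sphW N k / sphW N (k + 3)) * (1 / (2 * ((k : ℝ) + 3) * ((k : ℝ) + m + 3)))

/-- `|symA| ≤ 3/2`. [folklore] -/
theorem abs_symA_le (m N i : ℕ) : |symA m N i| ≤ 3 / 2 := by
  cases i with
  | zero => norm_num [symA]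
  | succ k =>
    simp only [symA]
    have hk : (0 : ℝ) ≤ k := k.cast_nonneg
    have hr : 0 ≤ sphW N k / sphW N (k + 1) := (div_pos (sphW_pos N k) (sphW_pos N (k + 1))).le
    have hr1 : sphW N k / sphW N (k + 1) ≤ 1 := sphW_div_le_one (Nat.le_succ k)
    have hf : 0 ≤ (k : ℝ) * ((k : ℝ) + 2 * m + 1) / (2 * ((k : ℝ) + 1) * ((k : ℝ) + m + 1)) := by positivity
    have hf1 : (k : ℝ) * ((k : ℝ) + 2 * m + 1) / (2 * ((k : ℝ) + 1) * ((k : ℝ) + m + 1)) ≤ 1 := by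
      rw [div_le_one (by positivity)]
      nlinarith [m.cast_nonneg (α := ℝ)]
    rw [abs_of_nonneg (by positivity)]
    calc 3 / 2 * (sphW N k / sphW N (k + 1)) * ((k : ℝ) * ((k : ℝ) + 2 * m + 1) / (2 * ((k : ℝ) + 1) * ((k : ℝ) + m + 1)))
        ≤ 3 / 2 * 1 * 1 := by gcongr
      _ = 3 / 2 := by norm_num

/-- `|symB| ≤ 3/2`. [folklore] -/
theorem abs_symB_le (m N i : ℕ) : |symB m N i| ≤ 3 / 2 := by
  cases i with
  | zero => norm_num [symB]
  | succ k =>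
    simp only [symB]
    have hk : (0 : ℝ) ≤ k := k.cast_nonneg
    have hr : 0 ≤ sphW N k / sphW N (k + 1) := (div_pos (sphW_pos N k) (sphW_pos N (k + 1))).le
    have hr1 : sphW N k / sphW N (k + 1) ≤ 1 := sphW_div_le_one (Nat.le_succ k)
    have hf1 : 1 / (2 * ((k : ℝ) + 1) * ((k : ℝ) + m + 1)) ≤ 1 := by
      rw [div_le_one (by positivity)]
      nlinarith [m.cast_nonneg (α := ℝ)]
    rw [abs_of_nonneg (by positivity)]
    calc 3 / 2 * (sphW N k / sphW N (k + 1)) * (1 / (2 * ((k : ℝ) + 1) * ((k : ℝ) + m + 1)))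
        ≤ 3 / 2 * 1 * 1 := by gcongr
      _ = 3 / 2 := by norm_num

/-- `|symB1| ≤ (3/2)²`. [folklore] -/
theorem abs_symB1_le (m N i : ℕ) : |symB1 m N i| ≤ (3 / 2) ^ 2 := by
  match i with
  | 0 => norm_num [symB1]
  | 1 => norm_num [symB1]
  | k + 2 =>
    simp only [symB1]
    have hk : (0 : ℝ) ≤ k := k.cast_nonneg
    have hr : 0 ≤ sphW N k / sphW N (k + 2) := (div_pos (sphW_pos N k) (sphW_pos N (k + 2))).le
    have hr1 : sphW N k / sphW N (k + 2) ≤ 1 := sphW_div_le_one (by omega)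
    have hf1 : 1 / (((k : ℝ) + 2) * ((k : ℝ) + m + 2)) ≤ 1 := by
      rw [div_le_one (by positivity)]
      nlinarith [m.cast_nonneg (α := ℝ)]
    rw [abs_of_nonneg (by positivity)]
    calc (3 / 2 : ℝ) ^ 2 * (sphW N k / sphW N (k + 2)) * (1 / (((k : ℝ) + 2) * ((k : ℝ) + m + 2)))
        ≤ (3 / 2) ^ 2 * 1 * 1 := by gcongr
      _ = (3 / 2) ^ 2 := by norm_num

/-- `|symB2| ≤ (3/2)³`. [folklore] -/
theorem abs_symB2_le (m N i : ℕ) : |symB2 m N i| ≤ (3 / 2) ^ 3 := by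
  match i with
  | 0 => norm_num [symB2]
  | 1 => norm_num [symB2]
  | 2 => norm_num [symB2]
  | k + 3 =>
    simp only [symB2]
    have hk : (0 : ℝ) ≤ k := k.cast_nonneg
    have hr : 0 ≤ sphW N k / sphW N (k + 3) := (div_pos (sphW_pos N k) (sphW_pos N (k + 3))).le
    have hr1 : sphW N k / sphW N (k + 3) ≤ 1 := sphW_div_le_one (by omega)
    have hf1 : 1 / (2 * ((k : ℝ) + 3) * ((k : ℝ) + m + 3)) ≤ 1 := by
      rw [div_le_one (by positivity)]
      nlinarith [m.cast_nonneg (α := ℝ)]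
    rw [neg_mul, neg_mul, abs_neg, abs_of_nonneg (by positivity)]
    calc (3 / 2 : ℝ) ^ 3 * (sphW N k / sphW N (k + 3)) * (1 / (2 * ((k : ℝ) + 3) * ((k : ℝ) + m + 3)))
        ≤ (3 / 2) ^ 3 * 1 * 1 := by gcongr
      _ = (3 / 2) ^ 3 := by norm_num

/-- The fixed symbols as elements of the coefficient space `ℕ →ᵇ ℂ`. [folklore] -/
def csA (m N : ℕ) : CSeq := CSeq.mk (fun i ↦ (symA m N i : ℂ)) (3 / 2) fun i ↦ by
  rw [Complex.norm_real, Real.norm_eq_abs]; exact abs_symA_le m N i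

/-- See `csA`. [folklore] -/
def csB (m N : ℕ) : CSeq := CSeq.mk (fun i ↦ (symB m N i : ℂ)) (3 / 2) fun i ↦ by
  rw [Complex.norm_real, Real.norm_eq_abs]; exact abs_symB_le m N i

/-- See `csA`. [folklore] -/
def csB1 (m N : ℕ) : CSeq := CSeq.mk (fun i ↦ (symB1 m N i : ℂ)) ((3 / 2) ^ 2) fun i ↦ by
  rw [Complex.norm_real, Real.norm_eq_abs]; exact abs_symB1_le m N i

/-- See `csA`. [folklore] -/
def csB2 (m N : ℕ) : CSeq := CSeq.mk (fun i ↦ (symB2 m N i : ℂ)) ((3 / 2) ^ 3) fun i ↦ by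
  rw [Complex.norm_real, Real.norm_eq_abs]; exact abs_symB2_le m N i

/-- The three multiplier symbols of the rescaled recursion, affine in the parameters `p = (ν, κ)`:
`d₀ = csA − (ν + κ) csB`, `d₁ = κ csB1`, `d₂ = κ csB2`. [folklore] -/
def sphmSym (m N : ℕ) (p : ℂ × ℂ) : Fin 3 → CSeq :=
  ![csA m N - (p.1 + p.2) • csB m N, p.2 • csB1 m N, p.2 • csB2 m N]

/-- **The recursion operator** of the rescaled Frobenius recursion. [cite: Hartman2002, Ch. IV §12 (12.12)] -/
def sphmOp (m N : ℕ) (p : ℂ × ℂ) : CSeq →L[ℂ] CSeq := CSeq.recOp 3 (sphmSym m N p)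

/-- `p ↦ sphmOp m N p` is smooth (affine). [folklore] -/
theorem contDiff_sphmOp (m N : ℕ) {n : WithTop ℕ∞} : ContDiff ℂ n fun p : ℂ × ℂ ↦ sphmOp m N p := by
  unfold sphmOp
  refine (CSeq.contDiff_recOp 3).comp ?_
  refine contDiff_pi.2 fun j ↦ ?_
  fin_cases j
  · simp only [sphmSym, Fin.zero_eta, Matrix.cons_val_zero]
    fun_prop
  · simp only [sphmSym, Fin.mk_one, Matrix.cons_val_one, Matrix.cons_val_zero]
    fun_prop
  · simp only [sphmSym, Fin.reduceFinMk, Matrix.cons_val]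
    fun_prop

/-- Coordinates of the symbols. [folklore] -/
theorem sphmSym_zero_apply (m N : ℕ) (p : ℂ × ℂ) (i : ℕ) :
    sphmSym m N p 0 i = (symA m N i : ℂ) - (p.1 + p.2) * (symB m N i : ℂ) := rfl

/-- Coordinates of the symbols. [folklore] -/
theorem sphmSym_one_apply (m N : ℕ) (p : ℂ × ℂ) (i : ℕ) : sphmSym m N p 1 i = p.2 * (symB1 m N i : ℂ) := rfl

/-- Coordinates of the symbols. [folklore] -/
theorem sphmSym_two_apply (m N : ℕ) (p : ℂ × ℂ) (i : ℕ) : sphmSym m N p 2 i = p.2 * (symB2 m N i : ℂ) := rfl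

/-- **The rescaled Frobenius sequence** `bₖ = cₖ (3/2)ᵏ / (k+1)^N` as the fixed point of the
recursion operator (meaningful where `‖sphmOp m N p‖ < 1`). [cite: Hartman2002, Ch. IV §12 (12.12)] -/
def sphmFix (m N : ℕ) (p : ℂ × ℂ) : CSeq := affineFix (sphmOp m N p) CSeq.unit

/-- The target of the identification: `gₖ = cₖ (3/2)ᵏ / Wₖ`. [folklore] -/
def sphmResc (m N : ℕ) (p : ℂ × ℂ) (k : ℕ) : ℂ := sphmCoeff m p.1 p.2 k * (3 / 2) ^ k / (sphW N k : ℂ)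

/-- The rescaled sequence satisfies the rescaled recursion: step from `k` to `k+1`, `k = 0`.
[folklore] -/
theorem sphmResc_step_zero (m N : ℕ) (p : ℂ × ℂ) :
    sphmResc m N p 1 = sphmSym m N p 0 1 * sphmResc m N p 0 := by
  have hrec := sphmCoeff_rec_zero m p.1 p.2
  have hW0 : (sphW N 0 : ℂ) ≠ 0 := by exact_mod_cast (sphW_pos N 0).ne'
  have hW1 : (sphW N 1 : ℂ) ≠ 0 := by exact_mod_cast (sphW_pos N 1).ne'
  have hm : (m : ℂ) + 1 ≠ 0 := by
    have : (0 : ℝ) < (m : ℝ) + 1 := by positivity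
    exact_mod_cast this.ne'
  have h0 : sphmCoeff m p.1 p.2 0 = 1 := rfl
  simp only [h0] at hrec
  simp only [sphmResc, sphmSym_zero_apply, symA, symB, h0, pow_zero, pow_one]
  push_cast
  field_simp
  linear_combination hrec

/-- The rescaled recursion, step to `k + 2` from `k+1`, `k`. [folklore] -/
theorem sphmResc_step_one (m N : ℕ) (p : ℂ × ℂ) :
    sphmResc m N p 2 = sphmSym m N p 0 2 * sphmResc m N p 1 + sphmSym m N p 1 2 * sphmResc m N p 0 := by
  have hrec := sphmCoeff_rec_one m p.1 p.2
  have hW0 : (sphW N 0 : ℂ) ≠ 0 := by exact_mod_cast (sphW_pos N 0).ne'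
  have hW1 : (sphW N 1 : ℂ) ≠ 0 := by exact_mod_cast (sphW_pos N 1).ne'
  have hW2 : (sphW N 2 : ℂ) ≠ 0 := by exact_mod_cast (sphW_pos N 2).ne'
  have hm1 : (m : ℂ) + 2 ≠ 0 := by
    have : (0 : ℝ) < (m : ℝ) + 2 := by positivity
    exact_mod_cast this.ne'
  have hm1' : (2 : ℂ) + m ≠ 0 := by rwa [add_comm]
  have hm2 : (1 : ℂ) + m + 1 ≠ 0 := by
    have : (0 : ℝ) < (1 : ℝ) + m + 1 := by positivity
    exact_mod_cast this.ne'
  have h0 : sphmCoeff m p.1 p.2 0 = 1 := rfl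
  simp only [h0] at hrec
  simp only [sphmResc, sphmSym_zero_apply, sphmSym_one_apply, symA, symB, symB1, h0, pow_zero, pow_one]
  push_cast
  rw [show (1 : ℂ) + m + 1 = (m : ℂ) + 2 by ring] at hrec ⊢
  rw [show (0 : ℂ) + 2 = 2 by ring, show (0 : ℂ) + m + 2 = (m : ℂ) + 2 by ring]
  field_simp
  linear_combination hrec

/-- The rescaled recursion, step to `k + 3` from `k+2`, `k+1`, `k`. [folklore] -/
theorem sphmResc_step_add_two (m N : ℕ) (p : ℂ × ℂ) (k : ℕ) :
    sphmResc m N p (k + 3) =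
      sphmSym m N p 0 (k + 3) * sphmResc m N p (k + 2) + sphmSym m N p 1 (k + 3) * sphmResc m N p (k + 1) +
        sphmSym m N p 2 (k + 3) * sphmResc m N p k := by
  have hrec := sphmCoeff_rec_add_two m p.1 p.2 k
  have hW0 : (sphW N k : ℂ) ≠ 0 := by exact_mod_cast (sphW_pos N k).ne'
  have hW1 : (sphW N (k + 1) : ℂ) ≠ 0 := by exact_mod_cast (sphW_pos N (k + 1)).ne'
  have hW2 : (sphW N (k + 2) : ℂ) ≠ 0 := by exact_mod_cast (sphW_pos N (k + 2)).ne'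
  have hW3 : (sphW N (k + 3) : ℂ) ≠ 0 := by exact_mod_cast (sphW_pos N (k + 3)).ne'
  have hk1 : (k : ℂ) + 3 ≠ 0 := by
    have : (0 : ℝ) < (k : ℝ) + 3 := by positivity
    exact_mod_cast this.ne'
  have hk2 : (k : ℂ) + 2 + m + 1 ≠ 0 := by
    have : (0 : ℝ) < (k : ℝ) + 2 + m + 1 := by positivity
    exact_mod_cast this.ne'
  simp only [sphmResc, sphmSym_zero_apply, sphmSym_one_apply, sphmSym_two_apply, symA, symB, symB1, symB2,
    show k + 2 + 1 = k + 3 from rfl]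
  push_cast
  rw [show (k : ℂ) + 2 + 1 = (k : ℂ) + 3 by ring, show (k : ℂ) + 1 + 2 = (k : ℂ) + 3 by ring,
    show (k : ℂ) + 1 + m + 2 = (k : ℂ) + 2 + m + 1 by ring,
    show (k : ℂ) + m + 3 = (k : ℂ) + 2 + m + 1 by ring]
  field_simp
  linear_combination (27 : ℂ) * (3 / 2 : ℂ) ^ k * hrec

/-- **Identification of the fixed point**: where the recursion operator is a contraction, its fixed
point is the rescaled Frobenius sequence `bₖ = cₖ (3/2)ᵏ / (k+1)^N`. [cite: Hartman2002, Ch. IV §12 (12.12)] -/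
theorem sphmFix_apply (m N : ℕ) {p : ℂ × ℂ} (hT : ‖sphmOp m N p‖ < 1) (k : ℕ) :
    sphmFix m N p k = sphmResc m N p k := by
  induction k using Nat.strong_induction_on with
  | _ k ih =>
    match k with
    | 0 =>
      rw [sphmFix, sphmOp, affineFix_recOp_apply_zero hT]
      simp [sphmResc, sphW]
    | 1 =>
      have e0 : affineFix (CSeq.recOp 3 (sphmSym m N p)) CSeq.unit 0 = sphmResc m N p 0 := ih 0 (by omega)
      rw [sphmFix, sphmOp, affineFix_recOp_apply_succ hT, Fin.sum_univ_three]
      simp only [Fin.val_zero, Fin.val_one, Fin.val_two, CSeq.unit_apply_succ, zero_add]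
      rw [if_pos le_rfl, if_neg (by omega), if_neg (by omega), add_zero, add_zero, Nat.sub_zero, e0,
        sphmResc_step_zero]
    | 2 =>
      have e0 : affineFix (CSeq.recOp 3 (sphmSym m N p)) CSeq.unit 0 = sphmResc m N p 0 := ih 0 (by omega)
      have e1 : affineFix (CSeq.recOp 3 (sphmSym m N p)) CSeq.unit 1 = sphmResc m N p 1 := ih 1 (by omega)
      rw [sphmFix, sphmOp, affineFix_recOp_apply_succ hT, Fin.sum_univ_three]
      simp only [Fin.val_zero, Fin.val_one, Fin.val_two, CSeq.unit_apply_succ, zero_add]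
      rw [if_pos (by omega), if_pos le_rfl, if_neg (by omega), add_zero, Nat.sub_zero, Nat.sub_self, e0, e1,
        sphmResc_step_one]
    | k + 3 =>
      have e0 : affineFix (CSeq.recOp 3 (sphmSym m N p)) CSeq.unit k = sphmResc m N p k := ih k (by omega)
      have e1 : affineFix (CSeq.recOp 3 (sphmSym m N p)) CSeq.unit (k + 1) = sphmResc m N p (k + 1) :=
        ih (k + 1) (by omega)
      have e2 : affineFix (CSeq.recOp 3 (sphmSym m N p)) CSeq.unit (k + 2) = sphmResc m N p (k + 2) :=
        ih (k + 2) (by omega)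
      rw [sphmFix, sphmOp, affineFix_recOp_apply_succ hT, Fin.sum_univ_three]
      simp only [Fin.val_zero, Fin.val_one, Fin.val_two, CSeq.unit_apply_succ, zero_add]
      rw [if_pos (by omega), if_pos (by omega), if_pos (by omega), Nat.sub_zero,
        show k + 2 - 1 = k + 1 from rfl, show k + 2 - 2 = k from rfl, e0, e1, e2, sphmResc_step_add_two]

/-! ### The contraction estimate `‖T(p)‖ ≤ 15/16` on a parameter disc -/

/-- Pointwise bound for the one-step symbol: `‖d₀(p)ᵢ‖ ≤ 7/8` for `‖ν‖ + ‖κ‖ ≤ R` and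
`N ≥ 2(1+R)(5m + 6R + 37)` (large indices: the multiplier tends to `3/4 < 7/8`; small indices:
the weight ratio `Wₖ/Wₖ₊₁ ≤ (k+1)/(k+1+N)` is small). [folklore] -/
theorem norm_sphmSym_zero_le (m N : ℕ) {R : ℝ} (hR : 0 ≤ R) (hN : 2 * (1 + R) * (5 * m + 6 * R + 37) ≤ N)
    {p : ℂ × ℂ} (hp : ‖p.1‖ + ‖p.2‖ ≤ R) (i : ℕ) : ‖sphmSym m N p 0 i‖ ≤ 7 / 8 := by
  rw [sphmSym_zero_apply]
  cases i with
  | zero => norm_num [symA, symB]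
  | succ k =>
    have hk : (0 : ℝ) ≤ k := k.cast_nonneg
    have hm : (0 : ℝ) ≤ m := m.cast_nonneg
    have hNpos : (0 : ℝ) < N := lt_of_lt_of_le (by nlinarith) hN
    set r : ℝ := sphW N k / sphW N (k + 1) with hr_def
    have hr0 : 0 ≤ r := (div_pos (sphW_pos N k) (sphW_pos N (k + 1))).le
    have hr1 : r ≤ 1 := sphW_div_le_one (Nat.le_succ k)
    have hrN : r ≤ ((k : ℝ) + 1) / ((k : ℝ) + 1 + N) := sphW_div_le (Nat.lt_succ_self k)
    set D : ℝ := 2 * ((k : ℝ) + 1) * ((k : ℝ) + m + 1) with hD_def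
    have hD : 0 < D := by positivity
    -- `‖d₀‖ ≤ (3/2) r (k(k+2m+1) + R)/D`
    have hbound : ‖((symA m N (k + 1) : ℝ) : ℂ) - (p.1 + p.2) * ((symB m N (k + 1) : ℝ) : ℂ)‖ ≤
        3 / 2 * r * (((k : ℝ) * ((k : ℝ) + 2 * m + 1) + R) / D) := by
      have hA : ((symA m N (k + 1) : ℝ)) = 3 / 2 * r * ((k : ℝ) * ((k : ℝ) + 2 * m + 1) / D) := rfl
      have hB : ((symB m N (k + 1) : ℝ)) = 3 / 2 * r * (1 / D) := rfl
      refine (norm_sub_le _ _).trans ?_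
      rw [norm_mul, Complex.norm_real, Complex.norm_real, Real.norm_eq_abs, Real.norm_eq_abs, hA, hB,
        abs_of_nonneg (by positivity), abs_of_nonneg (by positivity)]
      have hνκ : ‖p.1 + p.2‖ ≤ R := (norm_add_le _ _).trans hp
      calc 3 / 2 * r * ((k : ℝ) * ((k : ℝ) + 2 * m + 1) / D) + ‖p.1 + p.2‖ * (3 / 2 * r * (1 / D))
          ≤ 3 / 2 * r * ((k : ℝ) * ((k : ℝ) + 2 * m + 1) / D) + R * (3 / 2 * r * (1 / D)) := by
            gcongr
        _ = 3 / 2 * r * (((k : ℝ) * ((k : ℝ) + 2 * m + 1) + R) / D) := by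
            field_simp
    refine hbound.trans ?_
    rcases le_or_gt (5 * (m : ℝ) + 6 * R) k with hlarge | hsmall
    · -- large `k`: the multiplier itself is `≤ 7/8`
      have h1 : 3 / 2 * (((k : ℝ) * ((k : ℝ) + 2 * m + 1) + R) / D) ≤ 7 / 8 := by
        rw [← mul_div_assoc, div_le_iff₀ hD, hD_def]
        nlinarith [mul_nonneg hk (sub_nonneg.2 hlarge), hk, hm, hR]
      calc 3 / 2 * r * (((k : ℝ) * ((k : ℝ) + 2 * m + 1) + R) / D)
          = r * (3 / 2 * (((k : ℝ) * ((k : ℝ) + 2 * m + 1) + R) / D)) := by ring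
        _ ≤ 1 * (7 / 8) := by gcongr
        _ = 7 / 8 := one_mul _
    · -- small `k`: the weight ratio is small
      have hfrac : ((k : ℝ) * ((k : ℝ) + 2 * m + 1) + R) / D ≤ 1 + R / 2 := by
        rw [div_le_iff₀ hD, hD_def]
        nlinarith [hk, hm, hR, mul_nonneg hR hk, mul_nonneg hR hm, mul_nonneg (mul_nonneg hR hk) hk,
          mul_nonneg (mul_nonneg hR hk) hm, mul_nonneg hk hm]
      have hK : (k : ℝ) + 1 ≤ 5 * m + 6 * R + 1 := by linarith
      have hrK : r ≤ (5 * (m : ℝ) + 6 * R + 1) / N := by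
        refine hrN.trans ?_
        rw [div_le_div_iff₀ (by positivity) hNpos]
        nlinarith [hK, hNpos.le, hk]
      calc 3 / 2 * r * (((k : ℝ) * ((k : ℝ) + 2 * m + 1) + R) / D)
          ≤ 3 / 2 * ((5 * (m : ℝ) + 6 * R + 1) / N) * (1 + R / 2) := by gcongr
        _ ≤ 7 / 8 := by
            rw [show 3 / 2 * ((5 * (m : ℝ) + 6 * R + 1) / N) * (1 + R / 2) =
              (3 / 2 * (5 * (m : ℝ) + 6 * R + 1) * (1 + R / 2)) / N by ring, div_le_iff₀ hNpos]
            nlinarith [hN, hm, hR]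

/-- Pointwise bound for the two-step symbol: `‖d₁(p)ᵢ‖ ≤ 1/32`. [folklore] -/
theorem norm_sphmSym_one_le (m N : ℕ) {R : ℝ} (hR : 0 ≤ R) (hN : 2 * (1 + R) * (5 * m + 6 * R + 37) ≤ N)
    {p : ℂ × ℂ} (hp : ‖p.1‖ + ‖p.2‖ ≤ R) (i : ℕ) : ‖sphmSym m N p 1 i‖ ≤ 1 / 32 := by
  rw [sphmSym_one_apply, norm_mul, Complex.norm_real, Real.norm_eq_abs]
  have hκ : ‖p.2‖ ≤ R := le_trans (le_add_of_nonneg_left (norm_nonneg _)) hp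
  match i with
  | 0 => norm_num [symB1]
  | 1 => norm_num [symB1]
  | k + 2 =>
    have hk : (0 : ℝ) ≤ k := k.cast_nonneg
    have hm : (0 : ℝ) ≤ m := m.cast_nonneg
    have hNpos : (0 : ℝ) < N := lt_of_lt_of_le (by nlinarith) hN
    have hN72 : 72 * R ≤ N := by nlinarith [hN, hm, hR]
    set r : ℝ := sphW N k / sphW N (k + 2) with hr_def
    have hr0 : 0 ≤ r := (div_pos (sphW_pos N k) (sphW_pos N (k + 2))).le
    have hrN : r ≤ ((k : ℝ) + 1) / ((k : ℝ) + 1 + N) := sphW_div_le (by omega)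
    have hval : |symB1 m N (k + 2)| = (3 / 2) ^ 2 * r * (1 / (((k : ℝ) + 2) * ((k : ℝ) + m + 2))) := by
      simp only [symB1]
      rw [abs_of_nonneg (by positivity)]
    rw [hval]
    have h1 : r * (1 / (((k : ℝ) + 2) * ((k : ℝ) + m + 2))) ≤ 1 / N := by
      calc r * (1 / (((k : ℝ) + 2) * ((k : ℝ) + m + 2)))
          ≤ ((k : ℝ) + 1) / ((k : ℝ) + 1 + N) * (1 / (((k : ℝ) + 2) * ((k : ℝ) + m + 2))) := by gcongr
        _ ≤ 1 / N := by
            rw [div_mul_div_comm, div_le_div_iff₀ (by positivity) hNpos]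
            nlinarith [hk, hm, hNpos.le, mul_nonneg hk hm, mul_nonneg (mul_nonneg hk hk) hNpos.le,
              mul_nonneg hk hNpos.le, mul_nonneg hm hNpos.le]
    calc ‖p.2‖ * ((3 / 2 : ℝ) ^ 2 * r * (1 / (((k : ℝ) + 2) * ((k : ℝ) + m + 2))))
        = (3 / 2 : ℝ) ^ 2 * ‖p.2‖ * (r * (1 / (((k : ℝ) + 2) * ((k : ℝ) + m + 2)))) := by ring
      _ ≤ (3 / 2 : ℝ) ^ 2 * R * (1 / N) := by gcongr
      _ ≤ 1 / 32 := by
          rw [show (3 / 2 : ℝ) ^ 2 * R * (1 / N) = (9 / 4 * R) / N by ring, div_le_iff₀ hNpos]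
          nlinarith [hN72]

/-- Pointwise bound for the three-step symbol: `‖d₂(p)ᵢ‖ ≤ 1/32`. [folklore] -/
theorem norm_sphmSym_two_le (m N : ℕ) {R : ℝ} (hR : 0 ≤ R) (hN : 2 * (1 + R) * (5 * m + 6 * R + 37) ≤ N)
    {p : ℂ × ℂ} (hp : ‖p.1‖ + ‖p.2‖ ≤ R) (i : ℕ) : ‖sphmSym m N p 2 i‖ ≤ 1 / 32 := by
  rw [sphmSym_two_apply, norm_mul, Complex.norm_real, Real.norm_eq_abs]
  have hκ : ‖p.2‖ ≤ R := le_trans (le_add_of_nonneg_left (norm_nonneg _)) hp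
  match i with
  | 0 => norm_num [symB2]
  | 1 => norm_num [symB2]
  | 2 => norm_num [symB2]
  | k + 3 =>
    have hk : (0 : ℝ) ≤ k := k.cast_nonneg
    have hm : (0 : ℝ) ≤ m := m.cast_nonneg
    have hNpos : (0 : ℝ) < N := lt_of_lt_of_le (by nlinarith) hN
    have hN54 : 54 * R ≤ N := by nlinarith [hN, hm, hR]
    set r : ℝ := sphW N k / sphW N (k + 3) with hr_def
    have hr0 : 0 ≤ r := (div_pos (sphW_pos N k) (sphW_pos N (k + 3))).le
    have hrN : r ≤ ((k : ℝ) + 1) / ((k : ℝ) + 1 + N) := sphW_div_le (by omega)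
    have hval : |symB2 m N (k + 3)| = (3 / 2) ^ 3 * r * (1 / (2 * ((k : ℝ) + 3) * ((k : ℝ) + m + 3))) := by
      simp only [symB2]
      rw [neg_mul, neg_mul, abs_neg, abs_of_nonneg (by positivity)]
    rw [hval]
    have h1 : r * (1 / (2 * ((k : ℝ) + 3) * ((k : ℝ) + m + 3))) ≤ 1 / (2 * N) := by
      calc r * (1 / (2 * ((k : ℝ) + 3) * ((k : ℝ) + m + 3)))
          ≤ ((k : ℝ) + 1) / ((k : ℝ) + 1 + N) * (1 / (2 * ((k : ℝ) + 3) * ((k : ℝ) + m + 3))) := by gcongr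
        _ ≤ 1 / (2 * N) := by
            rw [div_mul_div_comm, div_le_div_iff₀ (by positivity) (by positivity)]
            nlinarith [hk, hm, hNpos.le, mul_nonneg hk hm, mul_nonneg (mul_nonneg hk hk) hNpos.le,
              mul_nonneg hk hNpos.le, mul_nonneg hm hNpos.le]
    calc ‖p.2‖ * ((3 / 2 : ℝ) ^ 3 * r * (1 / (2 * ((k : ℝ) + 3) * ((k : ℝ) + m + 3))))
        = (3 / 2 : ℝ) ^ 3 * ‖p.2‖ * (r * (1 / (2 * ((k : ℝ) + 3) * ((k : ℝ) + m + 3)))) := by ring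
      _ ≤ (3 / 2 : ℝ) ^ 3 * R * (1 / (2 * N)) := by gcongr
      _ ≤ 1 / 32 := by
          rw [show (3 / 2 : ℝ) ^ 3 * R * (1 / (2 * N)) = (27 / 16 * R) / N by ring, div_le_iff₀ hNpos]
          nlinarith [hN54]

/-- **The contraction estimate**: for `‖ν‖ + ‖κ‖ ≤ R` and `N ≥ 2(1+R)(5m + 6R + 37)` the rescaled
recursion operator has norm `≤ 15/16 < 1`. [folklore] -/
theorem norm_sphmOp_le (m N : ℕ) {R : ℝ} (hR : 0 ≤ R) (hN : 2 * (1 + R) * (5 * m + 6 * R + 37) ≤ N)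
    {p : ℂ × ℂ} (hp : ‖p.1‖ + ‖p.2‖ ≤ R) : ‖sphmOp m N p‖ ≤ 15 / 16 := by
  refine (CSeq.norm_recOp_le 3 _).trans ?_
  rw [Fin.sum_univ_three]
  have h0 : ‖sphmSym m N p 0‖ ≤ 7 / 8 :=
    (BoundedContinuousFunction.norm_le (by norm_num)).2 (norm_sphmSym_zero_le m N hR hN hp)
  have h1 : ‖sphmSym m N p 1‖ ≤ 1 / 32 :=
    (BoundedContinuousFunction.norm_le (by norm_num)).2 (norm_sphmSym_one_le m N hR hN hp)
  have h2 : ‖sphmSym m N p 2‖ ≤ 1 / 32 :=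
    (BoundedContinuousFunction.norm_le (by norm_num)).2 (norm_sphmSym_two_le m N hR hN hp)
  linarith

/-- A convenient admissible exponent: `N(m, R) = ⌈2(1+R)(5m + 6R + 37)⌉₊`. [folklore] -/
def sphmN (m : ℕ) (R : ℝ) : ℕ := ⌈2 * (1 + R) * (5 * m + 6 * R + 37)⌉₊

/-- `N(m, R)` is admissible. [folklore] -/
theorem le_sphmN (m : ℕ) (R : ℝ) : 2 * (1 + R) * (5 * m + 6 * R + 37) ≤ (sphmN m R : ℝ) :=
  Nat.le_ceil _

/-! ### Consequences: geometric bound, smoothness of the rescaled sequence in the parameters -/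

/-- The open parameter disc `‖ν‖ + ‖κ‖ < R`. [folklore] -/
theorem isOpen_paramDisc (R : ℝ) : IsOpen {p : ℂ × ℂ | ‖p.1‖ + ‖p.2‖ < R} :=
  isOpen_lt (continuous_fst.norm.add continuous_snd.norm) continuous_const

/-- **Smoothness of the rescaled Frobenius sequence in the parameters**: on the disc
`‖ν‖ + ‖κ‖ < R`, `p ↦ sphmFix m N(m,R) p ∈ ℕ →ᵇ ℂ` is `C^∞` (indeed holomorphic) —
`Literature.Analysis.ODE.contDiffOn_affineFix`. [folklore] -/
theorem contDiffOn_sphmFix (m : ℕ) (R : ℝ) (hR : 0 ≤ R) {n : WithTop ℕ∞} :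
    ContDiffOn ℂ n (fun p : ℂ × ℂ ↦ sphmFix m (sphmN m R) p) {p : ℂ × ℂ | ‖p.1‖ + ‖p.2‖ < R} := by
  refine contDiffOn_affineFix (isOpen_paramDisc R) (contDiff_sphmOp m _).contDiffOn contDiffOn_const ?_
  intro p hp
  exact (norm_sphmOp_le m _ hR (le_sphmN m R) (le_of_lt hp)).trans_lt (by norm_num)

/-- **Geometric bound on the Frobenius coefficients**: for `‖ν‖ + ‖κ‖ ≤ R`,
`‖cₖ(m; ν, κ)‖ ≤ 16 (k+1)^{N(m,R)} (2/3)ᵏ`; in particular the radius of convergence of `Σ cₖ tᵏ`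
is at least `3/2`. [cite: Hartman2002, Ch. IV §12 (12.12)] -/
theorem norm_sphmCoeff_le (m : ℕ) {R : ℝ} (hR : 0 ≤ R) {ν κ : ℂ} (hp : ‖ν‖ + ‖κ‖ ≤ R) (k : ℕ) :
    ‖sphmCoeff m ν κ k‖ ≤ 16 * ((k : ℝ) + 1) ^ sphmN m R * (2 / 3) ^ k := by
  set N := sphmN m R with hN_def
  have hT : ‖sphmOp m N (ν, κ)‖ ≤ 15 / 16 := norm_sphmOp_le m N hR (le_sphmN m R) hp
  have hT1 : ‖sphmOp m N (ν, κ)‖ < 1 := hT.trans_lt (by norm_num)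
  have hfix : ‖sphmFix m N (ν, κ)‖ ≤ 16 := by
    refine (norm_affineFix_le hT1 CSeq.unit).trans ?_
    have hu : ‖CSeq.unit‖ ≤ 1 := CSeq.norm_mk_le zero_le_one _
    rw [div_le_iff₀ (by linarith)]
    linarith
  have hk := (CSeq.norm_apply_le (sphmFix m N (ν, κ)) k).trans hfix
  rw [sphmFix_apply m N hT1 k, sphmResc] at hk
  simp only at hk
  rw [norm_div, norm_mul, Complex.norm_real, Real.norm_eq_abs, abs_of_pos (sphW_pos N k), norm_pow,
    div_le_iff₀ (sphW_pos N k)] at hk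
  rw [sphW] at hk
  have h32 : ‖(3 / 2 : ℂ)‖ = 3 / 2 := by norm_num
  rw [h32] at hk
  have hpow : (0 : ℝ) < (3 / 2 : ℝ) ^ k := by positivity
  calc ‖sphmCoeff m ν κ k‖ = ‖sphmCoeff m ν κ k‖ * (3 / 2) ^ k * (2 / 3) ^ k := by
        rw [mul_assoc, ← mul_pow]; norm_num
    _ ≤ 16 * ((k : ℝ) + 1) ^ N * (2 / 3) ^ k := by gcongr

end Engine

/-! ### The solution `Σ cₖ tᵏ`: convergence, the differential equation, reality -/

section Solution

variable (m : ℕ) (ν κ : ℂ)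

/-- **The Frobenius solution** `q(t) = Σₖ cₖ(m; ν, κ) tᵏ` at the pole of the `m`-spheroidal
equation (in the variable `t = 1 − cos θ`), for all complex `t` (Mathlib's junk value `0` off the
disc of convergence, which has radius `≥ 3/2`). SR, CMP 329 (2014), §2 (2.1) and App. B;
Hartman Ch. IV §12. [cite: ShlapentokhRothman2014KleinGordon, §2 (2.1)] -/
def sphmFun (t : ℂ) : ℂ := ∑' k, sphmCoeff m ν κ k * t ^ k

/-- The coefficients rescaled to the evaluation radius `5/4`: `aₖ = cₖ (5/4)ᵏ`. [folklore] -/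
def sphmResc54 (k : ℕ) : ℂ := sphmCoeff m ν κ k * (5 / 4) ^ k

/-- `aₖ = cₖ (5/4)ᵏ` is polynomially bounded (indeed `‖aₖ‖ ≤ 16 (k+1)^N (5/6)ᵏ`). [folklore] -/
theorem polyBounded_sphmResc54 : PolyBounded (sphmResc54 m ν κ) := by
  refine ⟨16, sphmN m (‖ν‖ + ‖κ‖), fun k ↦ ?_⟩
  have h := norm_sphmCoeff_le m (R := ‖ν‖ + ‖κ‖) (by positivity) (ν := ν) (κ := κ) le_rfl k
  rw [sphmResc54, norm_mul, norm_pow]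
  have h54 : ‖(5 / 4 : ℂ)‖ = 5 / 4 := by norm_num
  rw [h54]
  calc ‖sphmCoeff m ν κ k‖ * (5 / 4) ^ k ≤ 16 * ((k : ℝ) + 1) ^ sphmN m (‖ν‖ + ‖κ‖) * (2 / 3) ^ k * (5 / 4) ^ k := by
        gcongr
    _ = 16 * ((k : ℝ) + 1) ^ sphmN m (‖ν‖ + ‖κ‖) * (5 / 6) ^ k := by
        rw [mul_assoc, ← mul_pow]; norm_num
    _ ≤ 16 * ((k : ℝ) + 1) ^ sphmN m (‖ν‖ + ‖κ‖) * 1 := by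
        gcongr
        exact pow_le_one₀ (by norm_num) (by norm_num)
    _ = 16 * ((k : ℝ) + 1) ^ sphmN m (‖ν‖ + ‖κ‖) := mul_one _

variable {m ν κ}

/-- For `‖t‖ < 5/4` the rescaled point `(4/5) t` lies in the unit disc. [folklore] -/
theorem norm_rescale_lt {t : ℂ} (ht : ‖t‖ < 5 / 4) : ‖(4 / 5 : ℂ) * t‖ < 1 := by
  rw [norm_mul, show ‖(4 / 5 : ℂ)‖ = 4 / 5 by norm_num]
  linarith

/-- **The solution as a unit-disc series**: `q(t) = Σ aₖ ((4/5) t)ᵏ` for `‖t‖ < 5/4`. [folklore] -/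
theorem sphmFun_eq_cseries {t : ℂ} : sphmFun m ν κ t = cseries (sphmResc54 m ν κ) ((4 / 5 : ℂ) * t) := by
  rw [sphmFun, cseries]
  refine tsum_congr fun k ↦ ?_
  rw [sphmResc54, mul_pow, mul_assoc, ← mul_assoc ((5 / 4 : ℂ) ^ k), ← mul_pow]
  norm_num

/-- **Convergence**: `HasSum (cₖ tᵏ) (q(t))` for `‖t‖ < 5/4`. [folklore] -/
theorem hasSum_sphmFun {t : ℂ} (ht : ‖t‖ < 5 / 4) : HasSum (fun k ↦ sphmCoeff m ν κ k * t ^ k) (sphmFun m ν κ t) := by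
  have h := hasSum_cseries (polyBounded_sphmResc54 m ν κ) (norm_rescale_lt ht)
  rw [← sphmFun_eq_cseries] at h
  refine h.congr_fun fun k ↦ ?_
  rw [sphmResc54, mul_pow, mul_assoc, ← mul_assoc ((5 / 4 : ℂ) ^ k), ← mul_pow]
  norm_num

/-- `q(0) = 1`. [folklore] -/
theorem sphmFun_zero : sphmFun m ν κ 0 = 1 := by
  rw [sphmFun_eq_cseries, mul_zero, cseries_zero_right, sphmResc54, sphmCoeff_zero]
  simp

/-- The first `t`-derivative `q'(t) = (4/5) Σ (D a)ₖ ((4/5)t)ᵏ`. [folklore] -/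
def sphmDer (m : ℕ) (ν κ : ℂ) (t : ℂ) : ℂ := 4 / 5 * cseries (dSeq (sphmResc54 m ν κ)) ((4 / 5 : ℂ) * t)

/-- The second `t`-derivative `q''(t) = (4/5)² Σ (D² a)ₖ ((4/5)t)ᵏ`. [folklore] -/
def sphmDer2 (m : ℕ) (ν κ : ℂ) (t : ℂ) : ℂ :=
  (4 / 5) ^ 2 * cseries (dSeq (dSeq (sphmResc54 m ν κ))) ((4 / 5 : ℂ) * t)

/-- **`q` is differentiable with `q' = sphmDer`** on `‖t‖ < 5/4`. [folklore] -/
theorem hasDerivAt_sphmFun {t : ℂ} (ht : ‖t‖ < 5 / 4) : HasDerivAt (sphmFun m ν κ) (sphmDer m ν κ t) t := by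
  have h := hasDerivAt_cseries (polyBounded_sphmResc54 m ν κ) (norm_rescale_lt ht)
  have hlin : HasDerivAt (fun t : ℂ ↦ (4 / 5 : ℂ) * t) (4 / 5) t := by
    simpa using (hasDerivAt_id t).const_mul (4 / 5 : ℂ)
  have h2 : HasDerivAt (fun t : ℂ ↦ cseries (sphmResc54 m ν κ) ((4 / 5 : ℂ) * t))
      (cseries (dSeq (sphmResc54 m ν κ)) ((4 / 5 : ℂ) * t) * (4 / 5)) t := h.comp t hlin
  have hfun : sphmFun m ν κ = fun t ↦ cseries (sphmResc54 m ν κ) ((4 / 5 : ℂ) * t) :=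
    funext fun t ↦ sphmFun_eq_cseries
  rw [hfun, sphmDer, mul_comm]
  exact h2

/-- **`q'` is differentiable with derivative `sphmDer2`** on `‖t‖ < 5/4`. [folklore] -/
theorem hasDerivAt_sphmDer {t : ℂ} (ht : ‖t‖ < 5 / 4) : HasDerivAt (sphmDer m ν κ) (sphmDer2 m ν κ t) t := by
  have h := hasDerivAt_cseries (polyBounded_sphmResc54 m ν κ).dSeq (norm_rescale_lt ht)
  have hlin : HasDerivAt (fun t : ℂ ↦ (4 / 5 : ℂ) * t) (4 / 5) t := by
    simpa using (hasDerivAt_id t).const_mul (4 / 5 : ℂ)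
  have h2 : HasDerivAt (fun t : ℂ ↦ cseries (dSeq (sphmResc54 m ν κ)) ((4 / 5 : ℂ) * t))
      (cseries (dSeq (dSeq (sphmResc54 m ν κ))) ((4 / 5 : ℂ) * t) * (4 / 5)) t := h.comp t hlin
  have h3 := h2.const_mul (4 / 5 : ℂ)
  have hfun : sphmDer m ν κ = fun t ↦ (4 / 5 : ℂ) * cseries (dSeq (sphmResc54 m ν κ)) ((4 / 5 : ℂ) * t) := rfl
  rw [hfun]
  refine h3.congr_deriv ?_
  rw [sphmDer2]
  ring

/-- `deriv q = sphmDer` on `‖t‖ < 5/4`. [folklore] -/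
theorem deriv_sphmFun {t : ℂ} (ht : ‖t‖ < 5 / 4) : deriv (sphmFun m ν κ) t = sphmDer m ν κ t :=
  (hasDerivAt_sphmFun ht).deriv

/-- `deriv q' = sphmDer2` on `‖t‖ < 5/4`. [folklore] -/
theorem deriv_sphmDer {t : ℂ} (ht : ‖t‖ < 5 / 4) : deriv (sphmDer m ν κ) t = sphmDer2 m ν κ t :=
  (hasDerivAt_sphmDer ht).deriv

/-- The coefficient combination produced by inserting the series into the equation
`t(2 − t) q'' + 2(m+1)(1 − t) q' + (ν + κ(1 − t)²) q` (in the unit-disc variable `s = (4/5) t`):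
`(8/5) S(D²a) − S²(D²a) + (8(m+1)/5) Da − 2(m+1) S(Da) + (ν + κ) a − (5/2) κ S a + (25/16) κ S² a`.
[folklore] -/
def sphmODECoeff (m : ℕ) (ν κ : ℂ) (k : ℕ) : ℂ :=
  8 / 5 * shiftSeq (dSeq (dSeq (sphmResc54 m ν κ))) k - shiftSeq (shiftSeq (dSeq (dSeq (sphmResc54 m ν κ)))) k +
    8 * ((m : ℂ) + 1) / 5 * dSeq (sphmResc54 m ν κ) k - 2 * ((m : ℂ) + 1) * shiftSeq (dSeq (sphmResc54 m ν κ)) k +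
    (ν + κ) * sphmResc54 m ν κ k - 5 / 2 * κ * shiftSeq (sphmResc54 m ν κ) k +
    25 / 16 * κ * shiftSeq (shiftSeq (sphmResc54 m ν κ)) k

/-- **The recursion kills every coefficient of the inserted series.** [cite: Hartman2002, Ch. IV §12 (12.12)] -/
theorem sphmODECoeff_eq_zero (m : ℕ) (ν κ : ℂ) (k : ℕ) : sphmODECoeff m ν κ k = 0 := by
  match k with
  | 0 =>
    have hrec := sphmCoeff_rec_zero m ν κ
    simp only [sphmODECoeff, shiftSeq_zero, dSeq_apply, sphmResc54, sphmCoeff_zero] at hrec ⊢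
    push_cast at hrec ⊢
    linear_combination hrec
  | 1 =>
    have hrec := sphmCoeff_rec_one m ν κ
    simp only [sphmODECoeff, shiftSeq_zero, shiftSeq_succ, dSeq_apply, sphmResc54, sphmCoeff_zero] at hrec ⊢
    push_cast at hrec ⊢
    linear_combination (5 / 4 : ℂ) * hrec
  | k + 2 =>
    have hrec := sphmCoeff_rec_add_two m ν κ k
    simp only [sphmODECoeff, shiftSeq_succ, dSeq_apply, sphmResc54] at hrec ⊢
    push_cast at hrec ⊢
    linear_combination (5 / 4 : ℂ) ^ (k + 2) * hrec

/-- **The Frobenius solution solves the spheroidal equation at the pole**: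
`t(2 − t) q'' + 2(m+1)(1 − t) q' + (ν + κ(1 − t)²) q = 0` for `‖t‖ < 5/4`. SR, CMP 329 (2014),
§2 (2.1) (in the variable `t = 1 − cos θ` after `S = sin^m θ · q`); Hartman Ch. IV §12.
[cite: ShlapentokhRothman2014KleinGordon, §2 (2.1)] -/
theorem sphmFun_ode {t : ℂ} (ht : ‖t‖ < 5 / 4) :
    t * (2 - t) * sphmDer2 m ν κ t + 2 * ((m : ℂ) + 1) * (1 - t) * sphmDer m ν κ t +
      (ν + κ * (1 - t) ^ 2) * sphmFun m ν κ t = 0 := by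
  set a := sphmResc54 m ν κ with ha_def
  set s : ℂ := (4 / 5 : ℂ) * t with hs_def
  have hs : ‖s‖ < 1 := norm_rescale_lt ht
  have ha : PolyBounded a := polyBounded_sphmResc54 m ν κ
  have hDa : PolyBounded (dSeq a) := ha.dSeq
  have hDDa : PolyBounded (dSeq (dSeq a)) := hDa.dSeq
  -- the shifted series
  have e1 : cseries (shiftSeq (dSeq (dSeq a))) s = s * cseries (dSeq (dSeq a)) s := cseries_shiftSeq hDDa hs
  have e2 : cseries (shiftSeq (shiftSeq (dSeq (dSeq a)))) s = s * (s * cseries (dSeq (dSeq a)) s) := by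
    rw [cseries_shiftSeq hDDa.shift hs, e1]
  have e3 : cseries (shiftSeq (dSeq a)) s = s * cseries (dSeq a) s := cseries_shiftSeq hDa hs
  have e4 : cseries (shiftSeq a) s = s * cseries a s := cseries_shiftSeq ha hs
  have e5 : cseries (shiftSeq (shiftSeq a)) s = s * (s * cseries a s) := by
    rw [cseries_shiftSeq ha.shift hs, e4]
  -- the combination is the zero series
  have hzero : cseries (sphmODECoeff m ν κ) s = 0 := cseries_eq_zero (sphmODECoeff_eq_zero m ν κ) s
  -- expand the combination by linearity
  have hsum : cseries (sphmODECoeff m ν κ) s =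
      8 / 5 * cseries (shiftSeq (dSeq (dSeq a))) s - cseries (shiftSeq (shiftSeq (dSeq (dSeq a)))) s +
        8 * ((m : ℂ) + 1) / 5 * cseries (dSeq a) s - 2 * ((m : ℂ) + 1) * cseries (shiftSeq (dSeq a)) s +
        (ν + κ) * cseries a s - 5 / 2 * κ * cseries (shiftSeq a) s +
        25 / 16 * κ * cseries (shiftSeq (shiftSeq a)) s := by
    have p1 : PolyBounded (fun k ↦ 8 / 5 * shiftSeq (dSeq (dSeq a)) k) := hDDa.shift.const_mul _
    have p2 : PolyBounded (fun k ↦ shiftSeq (shiftSeq (dSeq (dSeq a))) k) := hDDa.shift.shift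
    have p3 : PolyBounded (fun k ↦ 8 * ((m : ℂ) + 1) / 5 * dSeq a k) := hDa.const_mul _
    have p4 : PolyBounded (fun k ↦ 2 * ((m : ℂ) + 1) * shiftSeq (dSeq a) k) := hDa.shift.const_mul _
    have p5 : PolyBounded (fun k ↦ (ν + κ) * a k) := ha.const_mul _
    have p6 : PolyBounded (fun k ↦ 5 / 2 * κ * shiftSeq a k) := ha.shift.const_mul _
    have p7 : PolyBounded (fun k ↦ 25 / 16 * κ * shiftSeq (shiftSeq a) k) := ha.shift.shift.const_mul _
    have step : cseries (sphmODECoeff m ν κ) s =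
        cseries (fun k ↦ 8 / 5 * shiftSeq (dSeq (dSeq a)) k - shiftSeq (shiftSeq (dSeq (dSeq a))) k +
          8 * ((m : ℂ) + 1) / 5 * dSeq a k - 2 * ((m : ℂ) + 1) * shiftSeq (dSeq a) k +
          (ν + κ) * a k - 5 / 2 * κ * shiftSeq a k) s +
        cseries (fun k ↦ 25 / 16 * κ * shiftSeq (shiftSeq a) k) s := by
      rw [← cseries_add ((((((p1.sub p2).add p3).sub p4).add p5).sub p6)) p7 hs]
      rfl
    rw [step, cseries_sub (((((p1.sub p2).add p3).sub p4).add p5)) p6 hs,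
      cseries_add ((((p1.sub p2).add p3).sub p4)) p5 hs, cseries_sub (((p1.sub p2).add p3)) p4 hs,
      cseries_add ((p1.sub p2)) p3 hs, cseries_sub p1 p2 hs]
    simp only [cseries_const_mul]
  -- assemble
  have hq : sphmFun m ν κ t = cseries a s := sphmFun_eq_cseries
  have hq' : sphmDer m ν κ t = 4 / 5 * cseries (dSeq a) s := rfl
  have hq'' : sphmDer2 m ν κ t = (4 / 5) ^ 2 * cseries (dSeq (dSeq a)) s := rfl
  rw [hsum, e1, e2, e3, e4, e5] at hzero
  rw [hq, hq', hq'']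
  have ht' : t = 5 / 4 * s := by rw [hs_def]; ring
  rw [ht']
  linear_combination hzero

/-- A unit-disc series with real coefficients is real at real points. [folklore] -/
theorem im_cseries_ofReal {a : ℕ → ℂ} (ha : PolyBounded a) (hreal : ∀ k, (a k).im = 0) {x : ℝ}
    (hx : |x| < 1) : (cseries a (x : ℂ)).im = 0 := by
  have hn : ‖(x : ℂ)‖ < 1 := by rwa [Complex.norm_real, Real.norm_eq_abs]
  have h := hasSum_cseries ha hn
  rw [← h.tsum_eq, Complex.im_tsum h.summable]
  have hterm : ∀ k, (a k * (x : ℂ) ^ k).im = 0 := fun k ↦ by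
    rw [← Complex.ofReal_pow, Complex.mul_im, Complex.ofReal_im, Complex.ofReal_re, hreal k]
    ring
  simp only [hterm, tsum_zero]

/-- The rescaled coefficients are real for real parameters. [folklore] -/
theorem im_sphmResc54 {ν κ : ℂ} (hν : ν.im = 0) (hκ : κ.im = 0) (k : ℕ) : (sphmResc54 m ν κ k).im = 0 := by
  rw [sphmResc54, show (5 / 4 : ℂ) = ((5 / 4 : ℝ) : ℂ) by push_cast; ring, ← Complex.ofReal_pow,
    Complex.mul_im, Complex.ofReal_im, Complex.ofReal_re, im_sphmCoeff m hν hκ k]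
  ring

/-- **Reality**: for real `ν`, `κ` and real `t`, `q(t)` is real. [folklore] -/
theorem im_sphmFun_ofReal {ν κ : ℂ} (hν : ν.im = 0) (hκ : κ.im = 0) {t : ℝ} (ht : |t| < 5 / 4) :
    (sphmFun m ν κ (t : ℂ)).im = 0 := by
  rw [sphmFun_eq_cseries, show (4 / 5 : ℂ) * (t : ℂ) = (((4 / 5 : ℝ) * t : ℝ) : ℂ) by push_cast; ring]
  refine im_cseries_ofReal (polyBounded_sphmResc54 m ν κ) (im_sphmResc54 (m := m) hν hκ) ?_
  rw [abs_mul, abs_of_pos (by norm_num : (0 : ℝ) < 4 / 5)]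
  linarith

/-- **Reality of the derivative** for real parameters and real `t`. [folklore] -/
theorem im_sphmDer_ofReal {ν κ : ℂ} (hν : ν.im = 0) (hκ : κ.im = 0) {t : ℝ} (ht : |t| < 5 / 4) :
    (sphmDer m ν κ (t : ℂ)).im = 0 := by
  rw [sphmDer, show (4 / 5 : ℂ) * (t : ℂ) = (((4 / 5 : ℝ) * t : ℝ) : ℂ) by push_cast; ring,
    show (4 / 5 : ℂ) = ((4 / 5 : ℝ) : ℂ) by push_cast; ring, Complex.mul_im, Complex.ofReal_im,
    Complex.ofReal_re]
  have hd : (cseries (dSeq (sphmResc54 m ν κ)) ((((4 / 5 : ℝ) * t : ℝ) : ℂ))).im = 0 := by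
    refine im_cseries_ofReal (polyBounded_sphmResc54 m ν κ).dSeq (fun k ↦ ?_) ?_
    · rw [dSeq_apply, show ((k : ℂ) + 1) = (((k : ℝ) + 1 : ℝ) : ℂ) by push_cast; ring, Complex.mul_im,
        Complex.ofReal_im, Complex.ofReal_re, im_sphmResc54 (m := m) hν hκ (k + 1)]
      ring
    · rw [abs_mul, abs_of_pos (by norm_num : (0 : ℝ) < 4 / 5)]
      linarith
  rw [hd]
  ring

end Solution

/-! ### Joint smoothness in the variable and the parameters -/

section Smooth

/-- The bounded weight `wₖ = (k+1)^N (5/6)ᵏ` converting the fixed point `cₖ (3/2)ᵏ/(k+1)^N` into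
the evaluation coefficients `cₖ (5/4)ᵏ` (bounded by the sum of the convergent series `Σ wⱼ`).
[folklore] -/
def sphmWeight (N : ℕ) : CSeq :=
  CSeq.mk (fun k ↦ ((((k : ℝ) + 1) ^ N * (5 / 6 : ℝ) ^ k : ℝ) : ℂ)) (∑' j : ℕ, ((j : ℝ) + 1) ^ N * (5 / 6 : ℝ) ^ j)
    fun k ↦ by
      rw [Complex.norm_real, Real.norm_eq_abs, abs_of_nonneg (by positivity)]
      exact (summable_succ_pow_mul_geometric N (by norm_num) (by norm_num)).le_tsum k
        fun j _ ↦ by positivity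

/-- Coordinates of the weight. [folklore] -/
theorem sphmWeight_apply (N k : ℕ) : sphmWeight N k = ((((k : ℝ) + 1) ^ N * (5 / 6 : ℝ) ^ k : ℝ) : ℂ) := rfl

/-- **The evaluation coefficient sequence** `p ↦ (cₖ(p) (5/4)ᵏ)ₖ ∈ ℕ →ᵇ ℂ` as a continuous linear
image of the fixed point. [folklore] -/
def sphmEvalSeq (m N : ℕ) (p : ℂ × ℂ) : CSeq := CSeq.mulCLM (sphmWeight N) (sphmFix m N p)

/-- On the parameter disc the evaluation sequence has coordinates `cₖ (5/4)ᵏ`. [folklore] -/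
theorem sphmEvalSeq_apply (m : ℕ) {R : ℝ} (hR : 0 ≤ R) {p : ℂ × ℂ} (hp : ‖p.1‖ + ‖p.2‖ ≤ R) (k : ℕ) :
    sphmEvalSeq m (sphmN m R) p k = sphmResc54 m p.1 p.2 k := by
  have hT1 : ‖sphmOp m (sphmN m R) p‖ < 1 :=
    (norm_sphmOp_le m _ hR (le_sphmN m R) hp).trans_lt (by norm_num)
  rw [sphmEvalSeq, CSeq.mulCLM_apply, sphmFix_apply m _ hT1 k, sphmResc, sphmWeight_apply, sphmResc54]
  have hW : (sphW (sphmN m R) k : ℂ) ≠ 0 := by exact_mod_cast (sphW_pos _ k).ne'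
  rw [sphW] at hW ⊢
  field_simp
  push_cast
  have h54 : ((5 : ℂ) / 4) ^ k = ((5 : ℂ) / 6) ^ k * ((3 : ℂ) / 2) ^ k := by rw [← mul_pow]; norm_num
  rw [h54]
  ring

/-- `p ↦ sphmEvalSeq m N(m,R) p` is `C^∞` on the parameter disc. [folklore] -/
theorem contDiffOn_sphmEvalSeq (m : ℕ) (R : ℝ) (hR : 0 ≤ R) {n : WithTop ℕ∞} :
    ContDiffOn ℂ n (fun p : ℂ × ℂ ↦ sphmEvalSeq m (sphmN m R) p) {p : ℂ × ℂ | ‖p.1‖ + ‖p.2‖ < R} :=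
  ((CSeq.mulCLM (sphmWeight (sphmN m R))).contDiff.comp_contDiffOn (contDiffOn_sphmFix m R hR))

/-- The open region `{‖t‖ < 5/4} × {‖ν‖ + ‖κ‖ < R}`. [folklore] -/
theorem isOpen_region (R : ℝ) : IsOpen {q : ℂ × (ℂ × ℂ) | ‖q.1‖ < 5 / 4 ∧ ‖q.2.1‖ + ‖q.2.2‖ < R} :=
  (isOpen_lt continuous_fst.norm continuous_const).inter
    (isOpen_lt ((continuous_fst.comp continuous_snd).norm.add (continuous_snd.comp continuous_snd).norm)
      continuous_const)

/-- **Joint smoothness of the Frobenius solution in the variable and the parameters**: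
`(t, ν, κ) ↦ q(t; m, ν, κ)` is `C^∞` (over `ℂ`, i.e. holomorphic) on `{‖t‖ < 5/4} × {‖ν‖ + ‖κ‖ < R}`
for every `R` (hence on `{‖t‖ < 5/4} × ℂ²`). SR, CMP 329 (2014), App. B (analytic dependence of the
angular problem on the spheroidal parameter). [cite: ShlapentokhRothman2014KleinGordon, App. B] -/
theorem contDiffOn_sphmFun (m : ℕ) (R : ℝ) {n : WithTop ℕ∞} (hn : n ≤ ∞) :
    ContDiffOn ℂ n (fun q : ℂ × (ℂ × ℂ) ↦ sphmFun m q.2.1 q.2.2 q.1)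
      {q : ℂ × (ℂ × ℂ) | ‖q.1‖ < 5 / 4 ∧ ‖q.2.1‖ + ‖q.2.2‖ < R} := by
  rcases lt_or_ge R 0 with hR | hR
  · -- empty region
    intro q hq
    exact absurd (hq.2.trans hR) (not_lt.2 (by positivity))
  intro q hq
  have hO := isOpen_region R
  -- smoothness of the evaluation-functional form at `q`
  have hβ : ContDiffAt ℂ n (fun q : ℂ × (ℂ × ℂ) ↦ sphmEvalSeq m (sphmN m R) q.2) q :=
    ((contDiffOn_sphmEvalSeq m R hR).contDiffAt ((isOpen_paramDisc R).mem_nhds hq.2)).comp q contDiffAt_snd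
  have hξ : ContDiffAt ℂ n (fun q : ℂ × (ℂ × ℂ) ↦ (4 / 5 : ℂ) * q.1) q := contDiffAt_const.mul contDiffAt_fst
  have h := contDiffAt_evCLM_apply hn 0 hβ hξ (norm_rescale_lt hq.1)
  -- identify with `sphmFun` near `q`
  have heq : (fun q : ℂ × (ℂ × ℂ) ↦ sphmFun m q.2.1 q.2.2 q.1) =ᶠ[𝓝 q]
      fun q : ℂ × (ℂ × ℂ) ↦ evCLM 0 ((4 / 5 : ℂ) * q.1) (sphmEvalSeq m (sphmN m R) q.2) := by
    filter_upwards [hO.mem_nhds hq] with q' hq'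
    rw [evCLM_zero_apply (norm_rescale_lt hq'.1), sphmFun_eq_cseries]
    exact cseries_congr (fun k ↦ (sphmEvalSeq_apply m hR (le_of_lt hq'.2) k).symm) _
  exact (h.congr_of_eventuallyEq heq).contDiffWithinAt

/-- **Joint smoothness of the `t`-derivative** `(t, ν, κ) ↦ q'(t; m, ν, κ)` on the same region.
[cite: ShlapentokhRothman2014KleinGordon, App. B] -/
theorem contDiffOn_sphmDer (m : ℕ) (R : ℝ) {n : WithTop ℕ∞} (hn : n ≤ ∞) :
    ContDiffOn ℂ n (fun q : ℂ × (ℂ × ℂ) ↦ sphmDer m q.2.1 q.2.2 q.1)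
      {q : ℂ × (ℂ × ℂ) | ‖q.1‖ < 5 / 4 ∧ ‖q.2.1‖ + ‖q.2.2‖ < R} := by
  rcases lt_or_ge R 0 with hR | hR
  · intro q hq
    exact absurd (hq.2.trans hR) (not_lt.2 (by positivity))
  intro q hq
  have hO := isOpen_region R
  have hβ : ContDiffAt ℂ n (fun q : ℂ × (ℂ × ℂ) ↦ sphmEvalSeq m (sphmN m R) q.2) q :=
    ((contDiffOn_sphmEvalSeq m R hR).contDiffAt ((isOpen_paramDisc R).mem_nhds hq.2)).comp q contDiffAt_snd
  have hξ : ContDiffAt ℂ n (fun q : ℂ × (ℂ × ℂ) ↦ (4 / 5 : ℂ) * q.1) q := contDiffAt_const.mul contDiffAt_fst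
  have h := (contDiffAt_evCLM_apply hn 1 hβ hξ (norm_rescale_lt hq.1)).const_smul (4 / 5 : ℂ)
  have heq : (fun q : ℂ × (ℂ × ℂ) ↦ sphmDer m q.2.1 q.2.2 q.1) =ᶠ[𝓝 q]
      fun q : ℂ × (ℂ × ℂ) ↦ (4 / 5 : ℂ) • evCLM 1 ((4 / 5 : ℂ) * q.1) (sphmEvalSeq m (sphmN m R) q.2) := by
    filter_upwards [hO.mem_nhds hq] with q' hq'
    rw [evCLM_one_apply (norm_rescale_lt hq'.1), sphmDer, smul_eq_mul]
    congr 1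
    refine cseries_congr (fun k ↦ ?_) _
    rw [dSeq_apply, dSeq_apply, sphmEvalSeq_apply m hR (le_of_lt hq'.2) (k + 1)]
  exact (h.congr_of_eventuallyEq heq).contDiffWithinAt

/-- Smoothness in the parameters alone at a fixed point `t₀` of the disc (e.g. the equator
`t₀ = 1`): `(ν, κ) ↦ q(t₀; m, ν, κ)` and `(ν, κ) ↦ q'(t₀; m, ν, κ)` are entire-smooth.
[cite: ShlapentokhRothman2014KleinGordon, App. B] -/
theorem contDiff_sphmFun_param (m : ℕ) {t₀ : ℂ} (ht₀ : ‖t₀‖ < 5 / 4) {n : WithTop ℕ∞} (hn : n ≤ ∞) :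
    ContDiff ℂ n (fun p : ℂ × ℂ ↦ sphmFun m p.1 p.2 t₀) := by
  rw [contDiff_iff_contDiffAt]
  intro p
  have hmem : (t₀, p) ∈ {q : ℂ × (ℂ × ℂ) | ‖q.1‖ < 5 / 4 ∧ ‖q.2.1‖ + ‖q.2.2‖ < ‖p.1‖ + ‖p.2‖ + 1} :=
    ⟨ht₀, by simp⟩
  have h := (contDiffOn_sphmFun m (‖p.1‖ + ‖p.2‖ + 1) hn).contDiffAt ((isOpen_region _).mem_nhds hmem)
  exact h.comp p (contDiffAt_const.prodMk contDiffAt_id)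

/-- See `contDiff_sphmFun_param`. [cite: ShlapentokhRothman2014KleinGordon, App. B] -/
theorem contDiff_sphmDer_param (m : ℕ) {t₀ : ℂ} (ht₀ : ‖t₀‖ < 5 / 4) {n : WithTop ℕ∞} (hn : n ≤ ∞) :
    ContDiff ℂ n (fun p : ℂ × ℂ ↦ sphmDer m p.1 p.2 t₀) := by
  rw [contDiff_iff_contDiffAt]
  intro p
  have hmem : (t₀, p) ∈ {q : ℂ × (ℂ × ℂ) | ‖q.1‖ < 5 / 4 ∧ ‖q.2.1‖ + ‖q.2.2‖ < ‖p.1‖ + ‖p.2‖ + 1} :=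
    ⟨ht₀, by simp⟩
  have h := (contDiffOn_sphmDer m (‖p.1‖ + ‖p.2‖ + 1) hn).contDiffAt ((isOpen_region _).mem_nhds hmem)
  exact h.comp p (contDiffAt_const.prodMk contDiffAt_id)

end Smooth

end Literature.Analysis.SpecialFunctions

end
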